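import Summits.AtomisticToContinuum.HydrodynamicLimit.Theorems.RelayRaceLocalityConeLocalisationBubbleAssembly
import Summits.AtomisticToContinuum.HydrodynamicLimit.Theorems.RelayRaceLocalityConeLocalisationBubbleZoomAdapter
import Summits.AtomisticToContinuum.HydrodynamicLimit.Theorems.RelayRaceLocalityConeLocalisationBubbleReadoutAdapter
import Summits.AtomisticToContinuum.HydrodynamicLimit.Theorems.RelayRaceLocalityConeLocalisationBubbleEnergy
import Summits.AtomisticToContinuum.HydrodynamicLimit.Theorems.RelayRaceLocalityConeLocalisationBubbleSupport
import Summits.AtomisticToContinuum.HydrodynamicLimit.Theorems.RelayRaceLocalityConeLocalisationBubbleExistence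
import Summits.AtomisticToContinuum.HydrodynamicLimit.Theorems.RelayRaceLocalityConeLocalisationStubFlatteningDensity
import Summits.AtomisticToContinuum.HydrodynamicLimit.Theorems.RelayRaceLocalityConeLocalisationFlooredModulo
import HarnessLib

/-!
# RelayRaceLocality · ConeLocalisation — stub `stub_bubble : BubbleAtScale` and the floored crux (final assembly)

Registered stub `stub_bubble` of the line `Sketch` (zoomed-bubble-transplant) of the crux item
`stmt-AtomisticToContinuum-12504` (`ConeLocalisation`, route RelayRaceLocality of `AtomisticToContinuum/HydrodynamicLimit`),
held by the lead prover-line-stmt-AtomisticToContinuum-12504-0 (2026-08-17): the bubble lemma `BubbleAtScale`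
(`…ConeLocalisationLocalDefs.lean`) is the assembly `Bubble.bubbleAtScale_of` (`…BubbleAssembly.lean`) of its five typed
analytic inputs (`…BubbleHypDefs.lean`), each discharged in its own file: zoom covariance `zoomHyp_holds`
(`…BubbleZoomAdapter.lean`), read-outs `readoutHyp_holds` (`…BubbleReadoutAdapter.lean`), the σ-uniform homogeneous
level-3 energy inequality `energyHyp_holds` (`…BubbleEnergy.lean`), finite-speed support preservation
`support_preservation` (`…BubbleSupport.lean`) and existence from a-priori bounds `exists_of_apriori_bounds`
(`…BubbleExistence.lean`).
-/

noncomputable section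

namespace Summit.AtomisticToContinuum.HydrodynamicLimit.Theorems.ConeLocalisation

open Summit.AtomisticToContinuum.HydrodynamicLimit.Theorems.ConeLocalisation.Bubble

/-- **Registered stub `stub_bubble` of line `Sketch`: bubbles at scale `r` with an `r`-free `C¹` guard.**
Assembly `bubbleAtScale_of` of the five analytic inputs: zoom covariance, read-outs, homogeneous level-3 energy
inequality, support preservation, existence from a-priori bounds. -/
theorem stub_bubble : BubbleAtScale :=
  bubbleAtScale_of zoomHyp_holds readoutHyp_holds energyHyp_holds support_preservation exists_of_apriori_bounds

/-- **The floored crux holds: `ConeLocalisationFloored` = `LightConeInLaw → NearConstantShortTimeHL → S♭`**, `S♭` being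
the consequent `S` of `ConeLocalisation` (stmt-AtomisticToContinuum-12504) with the density floor `M⁻¹ ≤ ρ s x` added to
its guards — the composition of the seven landed stubs of line `Sketch` (`coneLocalisationFloored_of_parts` composes
`stub_assembly`, `stub_coneStep`, `stub_comparison`, `stub_statics`, `stub_flatteningLinear` with the last two,
`stub_flatteningDensity` and `stub_bubble`). After the requested restatement of stmt-12504 (floor inserted after
`ρ s x ≤ M ∧`) this term proves `Theses.RelayRaceLocality.ConeLocalisation` verbatim. -/
theorem coneLocalisationFloored_holds : ConeLocalisationFloored :=
  coneLocalisationFloored_of_parts stub_flatteningDensity stub_bubble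

end Summit.AtomisticToContinuum.HydrodynamicLimit.Theorems.ConeLocalisation

end
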